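import Literature.Probability.Percolation.AdjOrder
import Literature.Probability.LatticeModels.TriMeshLattice
import HarnessLib

/-!
# Clean arms of the adjacent four-arm event and the order certificate on the inner circle

Topic `Literature/Probability/Percolation`; family `crit-perc` / near-critical percolation on `𝕋`.
A brick of the near-critical arm-separation theorem for four arms in the ADJACENT colour
arrangement (P. Nolin, EJP 13 (2008), Thm. 11, `j = 4`, `σ = BBWW` [arXiv 0711.4948: Thm. 10],
§4.1: the arms in counterclockwise order, `σ` up to cyclic permutation). The event
`adjFourArmCyc n N` gives four disjoint coloured walks of `{n ≤ |v| ≤ N}` from `∂Λ_n` to `∂Λ_N`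
whose closed outer extremities do NOT separate the open ones on `∂Λ_N`; the walks may touch the two
circles several times. Here we extract four CLEAN arms (each meets `∂Λ_n` only at its start and
`∂Λ_N` only at its end) through sites of the walks, and transport the order certificate to the INNER
circle: the closed starts do not separate the open starts on `∂Λ_n` (`exists_clean_arms`).

The transport: cut each walk at its last visit of `∂Λ_n` (the outer extremity is kept); prolong it
radially by one site beyond `∂Λ_N` — the prolonged walks are clean crossings of `{n ≤ |v| ≤ N+1}`,
so `hexSep_iff_of_four_paths` carries the pattern of the prolonged ends (an order-isomorphic image
of the pattern of the original ends, `hexPos_succ_mono`) to the starts; finally cut at the first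
visit of `∂Λ_N`.

Everything here is proved; no named facts are introduced.

## References

* P. Nolin, Near-critical percolation in two dimensions, *Electron. J. Probab.* 13 (2008), §4.1
  (arXiv 0711.4948, §4.1) [Nolin2008].
* B. Bollobás, O. Riordan, Percolation, CUP 2006, Ch. 7 Lemma 5 p. 169 [BollobasRiordan2006].
-/

noncomputable section

open Set

namespace Literature.Probability.Percolation

open LatticeModels

/-! ### Small geometric facts -/

/-- The radial successor: `ρ^i (N, t) ∼ ρ^i (N + 1, t)`. [folklore] -/
theorem rot_radial_adj (i : ℕ) (N t : ℤ) : triGraph.Adj (triRotIsoPow i ![N, t]) (triRotIsoPow i ![N + 1, t]) := by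
  rw [(triRotIsoPow i).map_adj_iff, LatticeModels.Mesh.triGraph_adj_iff_coord']
  left
  exact ⟨rfl, rfl⟩

/-- The norm of a point of the side `0`: `|(N, t)| = N` for `-N ≤ t ≤ 0`. [folklore] -/
theorem triNorm_side0_pt {N : ℕ} {t : ℤ} (ht : -(N : ℤ) ≤ t ∧ t ≤ 0) : triNorm (![(N : ℤ), t] : Site 2) = N := by
  have e0 : (![(N : ℤ), t] : Site 2) 0 = N := rfl
  have e1 : (![(N : ℤ), t] : Site 2) 1 = t := rfl
  apply le_antisymm
  · exact triNorm_le_iff_lin.2 (by rw [e0, e1]; omega)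
  · exact le_triNorm_iff_lin.2 (Or.inl (by rw [e0]))

/-- **The prolongation is order-isomorphic on perimeter positions**: with `P = iN + s`,
`P⁺ = i(N+1) + s + 1` (`0 ≤ s < N`), `P < P'` implies `P⁺ < P'⁺`. [folklore] -/
theorem hexPos_succ_mono {N : ℕ} {i i' : ℕ} {s s' : ℤ} (hs : 0 ≤ s ∧ s < N) (hs' : 0 ≤ s' ∧ s' < N)
    (h : (i : ℤ) * N + s < (i' : ℤ) * N + s') : (i : ℤ) * (N + 1) + s + 1 < (i' : ℤ) * (N + 1) + s' + 1 := by
  have hN : (0 : ℤ) ≤ N := by positivity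
  rcases le_or_gt i i' with hle | hlt
  · have : (i : ℤ) ≤ i' := by exact_mod_cast hle
    nlinarith
  · have : (i' : ℤ) + 1 ≤ i := by exact_mod_cast hlt
    nlinarith

/-- The representation `P = iN + s` (`0 ≤ s < N`) is unique. [folklore] -/
theorem hexPos_repr_inj {N : ℕ} {i i' : ℕ} {s s' : ℤ} (hs : 0 ≤ s ∧ s < N) (hs' : 0 ≤ s' ∧ s' < N)
    (h : (i : ℤ) * N + s = (i' : ℤ) * N + s') : i = i' ∧ s = s' := by
  have hN : (0 : ℤ) ≤ N := by positivity
  have hi : i = i' := by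
    rcases lt_trichotomy i i' with hl | hl | hl
    · have : (i : ℤ) + 1 ≤ i' := by exact_mod_cast hl
      nlinarith
    · exact hl
    · have : (i' : ℤ) + 1 ≤ i := by exact_mod_cast hl
      nlinarith
  subst hi
  exact ⟨rfl, by linarith⟩

/-- Separation patterns agree along an order correspondence of the four points. [folklore] -/
theorem hexSep_congr {a b c d a' b' c' d' : ℤ}
    (e2 : a < c ↔ a' < c') (e3 : a < d ↔ a' < d') (e4 : b < c ↔ b' < c') (e5 : b < d ↔ b' < d')
    (f2 : c < a ↔ c' < a') (f3 : d < a ↔ d' < a') (f4 : c < b ↔ c' < b') (f5 : d < b ↔ d' < b') :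
    HexSep a b c d ↔ HexSep a' b' c' d' := by
  unfold HexSep HexBtw
  rw [e2, e3, f4, f5, f2, f3, e4, e5]

/-! ### Clean arms with the order certificate on the inner circle -/

/-- **Clean arms of `adjFourArmCyc n N` with the inner order certificate** (`2 ≤ n`, `n + 1 ≤ N`):
four sets `W j ⊆ {n ≤ |v| ≤ N}` of sites of the colour of the arm `j` (open for `j = 0, 2`, closed
for `j = 1, 3`), pairwise disjoint, each carrying a path from `x j ∈ ∂Λ_n` to `y j ∈ ∂Λ_N` that meets
`∂Λ_n` only at `x j` and `∂Λ_N` only at `y j`; and on `∂Λ_n` the closed starts `x 1, x 3` do not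
separate the open starts `x 0, x 2`. [cite: Nolin2008, §4.1 (arXiv 0711.4948, §4.1: the arms in counterclockwise order)] [cite: BollobasRiordan2006, Ch. 7 Lemma 5 p. 169] -/
theorem exists_clean_arms {n N : ℕ} (hn : 1 ≤ n) (hnN : n + 1 ≤ N) {ω : SiteConfig (Site 2)} (hω : ω ∈ adjFourArmCyc n N) :
    ∃ (x y : Fin 4 → Site 2) (W : Fin 4 → Set (Site 2)),
      (∀ j, triNorm (x j) = n ∧ triNorm (y j) = N ∧ W j ⊆ triAnn n N ∧ PathIn triGraph (W j) (x j) (y j) ∧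
        (∀ v ∈ W j, triNorm v = n → v = x j) ∧ (∀ v ∈ W j, triNorm v = N → v = y j) ∧
        (∀ v ∈ W j, (v ∈ ω ↔ (![true, false, true, false] : Fin 4 → Bool) j))) ∧
      (Pairwise fun i j => Disjoint (W i) (W j)) ∧
      ¬ HexSep (hexPos n (x 1)) (hexPos n (x 3)) (hexPos n (x 0)) (hexPos n (x 2)) := by
  classical
  have hN : 1 ≤ N := by omega
  obtain ⟨x, y, w, hw, hdisj, hsep⟩ := hω
  -- the sites of the arms
  set A : Fin 4 → Set (Site 2) := fun j => {v | v ∈ (w j).support} with hA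
  have hxn : ∀ j, triNorm (x j) = n := fun j => (mem_triSphere_iff.1 (hw j).1)
  have hyN : ∀ j, triNorm (y j) = N := fun j => (mem_triSphere_iff.1 (hw j).2.1)
  have hAnn : ∀ j, ∀ v ∈ A j, (n : ℤ) ≤ triNorm v ∧ triNorm v ≤ N := fun j v hv => by
    rcases (hw j).2.2.2.1 v hv with ⟨h1, h2⟩ | h
    · have a1 := mem_triBall_iff.1 (Finset.mem_coe.1 h1)
      have a2 : ¬ triNorm v ≤ n := fun h' => h2 (Finset.mem_coe.2 (mem_triBall_iff.2 h'))
      omega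
    · have := mem_triSphere_iff.1 h; have := hyN j; omega
  have hcol : ∀ j, ∀ v ∈ A j, (v ∈ ω ↔ (![true, false, true, false] : Fin 4 → Bool) j) := fun j v hv => (hw j).2.2.2.2 v hv
  have hPA : ∀ j, PathIn triGraph (A j) (x j) (y j) := fun j => PathIn.of_walk (w j) fun v hv => hv
  have hdA : Pairwise fun i j => Disjoint (A i) (A j) := fun i j hij => by
    have h : Disjoint (w i).support.toFinset (w j).support.toFinset := hdisj hij
    rw [Finset.disjoint_left] at h
    exact Set.disjoint_left.2 fun v hv hv' => h (List.mem_toFinset.2 hv) (List.mem_toFinset.2 hv')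
  -- ### the last visit of `∂Λ_n`
  have inner : ∀ j, ∃ (a : Site 2) (W' : Set (Site 2)), triNorm a = n ∧ W' ⊆ A j ∧ PathIn triGraph W' a (y j) ∧
      (∀ v ∈ W', triNorm v = n → v = a) := fun j => by
    obtain ⟨a, b, haC, haA, hbC, hab, hP⟩ := (hPA j).last_exit (C := {v | triNorm v ≤ n}) (show triNorm (x j) ≤ n by rw [hxn j])
      (show ¬ triNorm (y j) ≤ n by rw [hyN j]; omega)
    refine ⟨a, insert a (A j \ {v | triNorm v ≤ n}), ?_, ?_, ?_, ?_⟩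
    · have := (hAnn j a haA).1; have : triNorm a ≤ n := haC; omega
    · exact Set.insert_subset haA fun v hv => hv.1
    · exact (PathIn.of_adj (Set.mem_insert _ _) (Set.mem_insert_of_mem _ hP.left_mem) hab).trans
        (hP.mono (Set.subset_insert _ _))
    · rintro v (rfl | ⟨-, hv⟩) hvn
      · rfl
      · exact absurd hvn.le hv
  choose a W' ha hW'A hPW' hinW' using inner
  -- ### the radial prolongation and the transport of the pattern to the inner circle
  have hsep' : ¬ HexSep (hexPos n (a 1)) (hexPos n (a 3)) (hexPos n (a 0)) (hexPos n (a 2)) := by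
    -- side and row of the outer extremities
    choose i hi t ht ht0 hyi using fun j => exists_rot_side0 hN (hyN j)
    set yp : Fin 4 → Site 2 := fun j => triRotIsoPow (i j) ![(N : ℤ) + 1, t j] with hyp
    have hypN : ∀ j, triNorm (yp j) = (N + 1 : ℕ) := fun j => by
      simp only [hyp, triNorm_rot]; push_cast; exact triNorm_side0_pt (N := N + 1) (by push_cast; constructor <;> linarith [ht j, ht0 j])
    have hadj : ∀ j, triGraph.Adj (y j) (yp j) := fun j => by rw [hyi j]; exact rot_radial_adj (i j) N (t j)
    set Wp : Fin 4 → Set (Site 2) := fun j => insert (yp j) (W' j) with hWp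
    have hW'n : ∀ j, ∀ v ∈ W' j, (n : ℤ) ≤ triNorm v ∧ triNorm v ≤ N := fun j v hv => hAnn j v (hW'A j hv)
    have key := hexSep_iff_of_four_paths (n := n) (N := N + 1) hn (by omega) (x := a) (y := yp) (W := Wp)
      (fun j => by
        rintro v (rfl | hv)
        · rw [mem_triAnn, hypN j]; push_cast; constructor <;> linarith
        · rw [mem_triAnn]; have := hW'n j v hv; push_cast; omega)
      ha hypN
      (fun j => ((hPW' j).mono (Set.subset_insert _ _)).tail (hadj j) (Set.mem_insert _ _))
      (fun j => by
        rintro v (rfl | hv) hvn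
        · rw [hypN j] at hvn; push_cast at hvn; omega
        · exact hinW' j v hv hvn)
      (fun j => by
        rintro v (rfl | hv) hvn
        · rfl
        · have := (hW'n j v hv).2; push_cast at hvn; omega)
      (fun j k hjk => by
        show Disjoint (Wp j) (Wp k)
        rw [Set.disjoint_left]
        rintro v (rfl | hv) hv'
        · rcases hv' with h | h
          · -- two prolonged ends coincide: then the ends coincide
            have hpj := hexPos_rot_side0 (N := N + 1) (hi j) (y := t j) (by push_cast; linarith [ht j]) (ht0 j)
            have hpk := hexPos_rot_side0 (N := N + 1) (hi k) (y := t k) (by push_cast; linarith [ht k]) (ht0 k)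
            have he : hexPos (N + 1) (yp j) = hexPos (N + 1) (yp k) := by rw [h]
            simp only [hyp] at he; push_cast at hpj hpk he; rw [hpj, hpk] at he
            have hij : i j = i k := by
              rcases lt_trichotomy (i j) (i k) with hl | hl | hl
              · have : (i j : ℤ) + 1 ≤ i k := by exact_mod_cast hl
                nlinarith [ht j, ht0 j, ht k, ht0 k]
              · exact hl
              · have : (i k : ℤ) + 1 ≤ i j := by exact_mod_cast hl
                nlinarith [ht j, ht0 j, ht k, ht0 k]
            have htt : t j = t k := by rw [hij] at he; linarith
            have hyy : y j = y k := by rw [hyi j, hyi k, hij, htt]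
            exact absurd hyy fun e => Set.disjoint_left.1 (hdA hjk) (w j).end_mem_support (by rw [e]; exact (w k).end_mem_support)
          · have := (hW'n k _ h).2; have h2 := hypN j; push_cast at h2; omega
        · rcases hv' with rfl | h
          · have := (hW'n j _ hv).2; have h2 := hypN k; push_cast at h2; omega
          · exact Set.disjoint_left.1 (hdA hjk) (hW'A j hv) (hW'A k h))
    -- the prolonged pattern is the original pattern
    have hpos : ∀ j, hexPos (N + 1) (yp j) = (i j : ℤ) * (N + 1) + (t j + N) + 1 ∧ hexPos N (y j) = (i j : ℤ) * N + (t j + N) := fun j => by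
      have h1 := hexPos_rot_side0 (N := N + 1) (hi j) (y := t j) (by push_cast; linarith [ht j]) (ht0 j)
      have h2 := hexPos_rot_side0 (N := N) (hi j) (ht j) (ht0 j)
      rw [← hyi j] at h2
      simp only [hyp]; push_cast at h1 ⊢
      exact ⟨by rw [h1]; ring, h2⟩
    have hs : ∀ j, 0 ≤ t j + N ∧ t j + N < N := fun j => ⟨by linarith [ht j], by linarith [ht0 j]⟩
    have iff1 : ∀ j k, hexPos N (y j) < hexPos N (y k) ↔ hexPos (N + 1) (yp j) < hexPos (N + 1) (yp k) := fun j k => by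
      rw [(hpos j).1, (hpos k).1, (hpos j).2, (hpos k).2]
      constructor
      · exact hexPos_succ_mono (hs j) (hs k)
      · intro h
        by_contra hle; push Not at hle
        rcases hle.lt_or_eq with hlt | heq
        · have := hexPos_succ_mono (hs k) (hs j) hlt; linarith
        · obtain ⟨h1, h2⟩ := hexPos_repr_inj (hs k) (hs j) heq
          rw [h1, h2] at h; exact lt_irrefl _ h
    rw [← key]
    rwa [← hexSep_congr (iff1 1 0) (iff1 1 2) (iff1 3 0) (iff1 3 2) (iff1 0 1) (iff1 2 1) (iff1 0 3) (iff1 2 3)]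
  -- ### the first visit of `∂Λ_N`
  have outer : ∀ j, ∃ (b : Site 2) (W'' : Set (Site 2)), triNorm b = N ∧ W'' ⊆ W' j ∧ PathIn triGraph W'' (a j) b ∧
      (∀ v ∈ W'', triNorm v = N → v = b) := fun j => by
    obtain ⟨a', b, ha'R, hbR, hbW, hab, hP⟩ := (hPW' j).exit (R := {v | triNorm v < N}) (show triNorm (a j) < N by rw [ha j]; omega)
      (show ¬ triNorm (y j) < N by rw [hyN j]; omega)
    refine ⟨b, insert b ({v | triNorm v < N} ∩ W' j), ?_, Set.insert_subset hbW Set.inter_subset_right, ?_, ?_⟩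
    · have := (hAnn j b (hW'A j hbW)).2; have : ¬ triNorm b < N := hbR; omega
    · exact (hP.mono (Set.subset_insert _ _)).tail hab (Set.mem_insert _ _)
    · rintro v (rfl | ⟨hv, -⟩) hvn
      · rfl
      · exact absurd hvn (ne_of_lt hv)
  choose b W'' hb hW''W hPW'' houtW'' using outer
  refine ⟨a, b, W'', fun j => ⟨ha j, hb j, fun v hv => ?_, hPW'' j, fun v hv hvn => hinW' j v (hW''W j hv) hvn, houtW'' j,
    fun v hv => hcol j v (hW'A j (hW''W j hv))⟩, fun j k hjk => ?_, hsep'⟩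
  · rw [mem_triAnn]; exact hAnn j v (hW'A j (hW''W j hv))
  · exact Set.disjoint_of_subset (fun v hv => hW'A j (hW''W j hv)) (fun v hv => hW'A k (hW''W k hv)) (hdA hjk)

end Literature.Probability.Percolation
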